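import Literature.MathematicalPhysics.QuantumFieldTheory.Balaban1983to89.B9Eq368TowerProjWordGradientLetters
import Literature.MathematicalPhysics.QuantumFieldTheory.Balaban1983to89.B9Eq375BondDivergenceTwoBackgroundLetterTower
import Literature.MathematicalPhysics.QuantumFieldTheory.Balaban1983to89.B9Eq325RofUkSupRowClosed
import Literature.MathematicalPhysics.QuantumFieldTheory.Balaban1983to89.B9Eq326G1SupRowOfLetters

/-!
# `Balaban1983to89.B9Eq376BondProjWordTwoBackgroundLetterTower` — T. Bałaban, *Propagators for lattice gauge theories in a background field*, Commun. Math. Phys. **99** (1985)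
# 389–434 [Balaban1985BackgroundPropagators] (3.76)–(3.77) p. 405 (*«D_{U′U}R(U′U)D*_{U′U} = DRD* − V₂(A) − P₁(A) … The operator P₁(A) … is a non-local bounded operator and satisfies the bound
# (3.77)»*), (3.25) p. 394, (3.68) p. 403, (3.84)–(3.85) p. 407, Thm 3.3 p. 399: **THE SMOOTH-WORD MEMBER OF THE TWO-BACKGROUND PERTURBATION OF THE NE9 CHAIN's `k`-LEVEL BOND
# PROPAGATOR AT THE FLAT BASE, AS A LOCAL LETTER WITH THE SMALL FACTOR** — `∃ α₀ K κ > 0` BEFORE `n, η, m, U`: on print's small-field class of the MODEL letters, for every source `f`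
# over ONE unit block `v` with `‖f‖_∞ ≤ F` and every bond `b`:
# `‖((D_UW_k(U)D*_U − D_1W_k(1)D*_1)G₁,k(1)f)(b)‖ ≤ K·α·e^{−κ d_m(Π(b₋), v)}·F`, `W_k(V) = 1 − R_k(V)` — the three-term telescoping
# `(D_U − D_1)W(U)D*_UG + D_1(R(1) − R(U))D*_UG + D_1W(1)(D*_U − D*_1)G` composed from this gen's letters (W-a `B9Eq368TowerProjWordGradientLetters`, W-b₁
# `B9Eq375BondDivergenceTwoBackgroundLetterTower`) and the crew's `R_k(U)` sup row (`B9Eq325RofUkSupRowClosed`) by ne9-leaf-05's letter algebra `B9Eq326G1SupRowOfLetters.letter_comp` — brick W-b₂;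
# with `B9Eq375BondGradDivTwoBackgroundLetterTower` (the `DD*` piece) it gives the `D_UR_k(U)D*_U − D_1R_k(1)D*_1` member of `Δ_{a,k}(U) − Δ_{a,k}(1)` against `G₁,k(1)` ((3.26))

statement-level skeleton of published theorems with citation tags; proofs where landed; nothing here is a claim about the Yang–Mills mass gap

CITATION HEADER (lean-in-tree rule).  Audit cell `pub-balaban`, sub-cell `t4`, BINDER row NE9; NE9 crux-team LEAF PROVER 01 (`b2b-balaban-t4-ne9-formalise-leaf-01`, gen 100;
bears_on: R4/N22).  Composition BY NAME: `B9Eq368TowerProjWordGradientLetters.{exists_gradLetter_RofUk_sub_flat, exists_gradLetter_W_one}`, `B9Eq375BondDivergenceTwoBackgroundLetterTower.exists_letters_covDiv_G1k_one`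
(this gen), `B9Eq325RofUkSupRowClosed.exists_local_letters_GpOfUk_RofUk` (ne9-leaf-05), `B9Eq326G1SupRowOfLetters.letter_comp` (ne9-leaf-05), `B4Sect5Torus.torusSum_le`,
`B9Eq375BondGradDivTwoBackgroundSplit.covDeriv_sub_flat_apply`, `B9Eq373TransporterLipschitzLetters`.  Sources: [Balaban1985BackgroundPropagators] pp. 394, 399, 403, 405, 407 (text layer
pp. 6, 11, 15, 17, 19 read by this lineage 2026-08-28).  NOTHING of print's proofs is reproduced beyond what the named files prove.

WHAT IS PROVED (sorry-free; proof lane — no `def`).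
* **`exists_letter_projWord_sub_flat_G1k_one`** — the statement of the title.
HONEST SCOPE.  Composition on the cell's MODEL rows («NE9 ⇐ the named binders»; O-NE9-1 #5 UNRULED); constants crude (NOT print's); the `Q_k†aQ_k` member and the resolvent step (3.86) are NOT here;
NE9 NOT PRINTED ∕ NOT PROVED; spine PROVED 0∕9; rung (B)+1 finite T⁴ — NOT infinite volume, NOT mass gap, NOT BetaPertH, NOT Clay.  HONEST DEPENDENCY: continuum YM on T⁴ ⇐ BetaPertH ∧ nine
spine estimates (0/9 proved); BetaPertH ⇐ (D1) ∧ (D4) ∧ CAP+tail; G-an2-4 gates asym, D1 and NE2/3/4.  NEW file; nothing modified.  Net new unproved facts: 0.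
-/

noncomputable section

set_option autoImplicit false

open scoped InnerProductSpace ComplexConjugate BigOperators

namespace Literature.MathematicalPhysics.QuantumFieldTheory.Balaban1983to89.B9Eq376BondProjWordTwoBackgroundLetterTower

open B4Sect5Torus (TSite tdist tdist_nonneg tdist_triangle tdist_symm torusSum_le tdist_self)
open B4Sect5Proof (latticeConst latticeConst_nonneg)
open B9SectCLatticeCarrier (Bond bpos btgt shift unshift shift_unshift)
open B9Eq311L2Pairing (WL2)
open B9Eq319QprimeTorus (blockCoord)
open B7Prop1Explicit (U1 Wcx boxVec)
open B11Eq103H1Complex (SiteL2K BondL2K covDerivL2K covDivL2K equiv_covDerivL2K)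
open B9Eq310DeltaPrime (plaqHolU)
open B9Eq310HessianOperator (adTransportW)
open B9Eq315QTorus (perCfg cornerSite)
open B9Eq315QTower (towerP UlevOf)
open B9Eq315QTowerFlat (perCfg_UlevOf_one_mem_U1 norm_Wcx_UlevOf_one_sub_one_le)
open B9Eq316TowerFlatIsOneStep (towerP_eq_fineP_pow siteCast)
open B9Eq326OperatorTower (laplaceAk G1k RofUk)
open B9Eq324DeltaPrimeATower (laplacePrimeAk)
open B9Eq33CovDerivVector (covDeriv)
open B9Eq33CovDerivLocalLetterTower (tdist_bigBlock_bpos_btgt_le_one)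
open B9Eq373TransporterLipschitzLetters (norm_adTransportW_sub_adTransportW_le)
open B9Eq373BondHessianTwoBackgroundLetterTower (adTransportW_one_fun)
open B9Eq375BondGradDivTwoBackgroundSplit (covDeriv_sub_flat_apply)
open B9Eq368TowerProjWordGradientLetters (exists_gradLetter_RofUk_sub_flat exists_gradLetter_W_one)
open B9Eq375BondDivergenceTwoBackgroundLetterTower (exists_letters_covDiv_G1k_one)
open B9Eq325RofUkSupRowClosed (exists_local_letters_GpOfUk_RofUk)
open B9Eq326G1SupRowOfLetters (letter_comp)

variable {d : ℕ} (hd : 1 ≤ d) (L : ℕ) [NeZero L] (hL : 1 ≤ L) (hL3 : 3 ≤ L)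
  {𝔸 : Type*} [NormedRing 𝔸] [NormedAlgebra ℂ 𝔸] [CompleteSpace 𝔸] [NormOneClass 𝔸] [StarRing 𝔸] [NormedStarGroup 𝔸] [StarModule ℂ 𝔸] [FiniteDimensional ℂ 𝔸]
  {W : Type*} [NormedAddCommGroup W] [InnerProductSpace ℂ W] [FiniteDimensional ℂ W] (φ : W ≃ₗ[ℂ] 𝔸)
  {Mφ Mφ' : ℝ} (hMφ : 0 ≤ Mφ) (hMφ' : 0 ≤ Mφ') (hφ : ∀ w, ‖φ w‖ ≤ Mφ * ‖w‖) (hφ' : ∀ X, ‖φ.symm X‖ ≤ Mφ' * ‖X‖) (hstar : ∀ X : 𝔸, ‖star X‖ ≤ ‖X‖)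
  {a : ℝ} (ha : 0 < a) {a' : ℝ} (ha' : 0 < a') {r : ℝ} (hr0 : 0 ≤ r) (hr1 : r < 1)
  (τ : 𝔸 →ₗ[ℂ] ℂ) {Cτ : ℝ} (hτ : ∀ X, ‖τ X‖ ≤ Cτ * ‖X‖) (hCτ : 0 ≤ Cτ) {Mτ : ℝ} (hτm : ∀ X Y : 𝔸, ‖τ (X * Y)‖ ≤ Mτ * ‖X‖ * ‖Y‖) (hMτ : 0 ≤ Mτ)
  {ρw : ℝ} (hρw : 0 ≤ ρw)
  (hτ₁ : ∀ X : 𝔸, τ (star X) = conj (τ X)) (hτ₂ : ∀ X Y : 𝔸, τ (X * Y) = τ (Y * X)) (hφτ : ∀ X Y : 𝔸, ⟪φ.symm X, φ.symm Y⟫_ℂ = τ (star X * Y))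
  {ι : Type} [Fintype ι] [DecidableEq ι] (b : Module.Basis ι ℝ 𝔸) {M₂ : ℝ} (hM₂ : 0 ≤ M₂) (hrepr : ∀ (v : 𝔸) (i : ι), |b.repr v i| ≤ M₂ * ‖v‖)
  (AQ : ℝ)

include hd hL hL3 hMφ hMφ' hφ hφ' hstar ha ha' hr0 hr1 hτ hCτ hτm hMτ hρw hτ₁ hτ₂ hφτ hM₂ hrepr in
set_option maxHeartbeats 3200000 in
/-- **THE SMOOTH-WORD MEMBER `(D_UW_k(U)D*_U − D_1W_k(1)D*_1)G₁,k(1)` AS A LOCAL LETTER WITH THE SMALL FACTOR, CONSTANTS BEFORE THE LATTICE** — see the module docstring.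
[cite: Balaban1985BackgroundPropagators, (3.76)–(3.77) p.405, (3.25) p.394, (3.68) p.403, (3.84)–(3.85) p.407, Thm 3.3 p.399] -/
theorem exists_letter_projWord_sub_flat_G1k_one :
    ∃ α₀ K κ : ℝ, 0 < α₀ ∧ 0 ≤ K ∧ 0 < κ ∧
      ∀ (n : ℕ) (η : ℝ), η * (L : ℝ) ^ (n + 1) = 1 →
      ∀ (c₀ c₁ : ℝ) [Fact (0 < c₀)] [Fact (0 < c₁)], c₀ * ((L : ℝ) ^ (n + 1)) ^ d = c₁ → |η| ^ d / c₀ ≤ ρw →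
      ∀ (m : Fin d → ℕ) [∀ i, NeZero (m i)], (∀ i, 1 ≤ m i) → ∀ (U : Bond d (towerP L m (n + 1)) → 𝔸ˣ) (α : ℝ), 0 ≤ α → α ≤ α₀ →
        (∀ bd, U bd ∈ U1 𝔸) → (∀ bd, ‖(U bd : 𝔸) - 1‖ ≤ α * η) →
        (∀ (x : TSite d (towerP L m (n + 1))) (μ ν : Fin d), ‖(U (shift ν x, μ) : 𝔸) - (U (x, μ) : 𝔸)‖ ≤ α * η ^ 2) →
        (∀ p : B9SectCLatticeCarrier.Plaq d (towerP L m (n + 1)), ‖(plaqHolU U p : 𝔸) - 1‖ ≤ α * η ^ 2) →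
      ∀ (hUst : ∀ bd, star (U bd : 𝔸) = (((U bd)⁻¹ : 𝔸ˣ) : 𝔸))
        (αU : ℕ → ℝ), (∀ j, 0 ≤ αU j) → ∀ (hα1 : ∀ j, αU j ≤ 1 / 64), (∑ j ∈ Finset.range (n + 1), αU j ≤ AQ) →
        ∀ (hU1 : ∀ (j : ℕ) (x : B7Prop1Explicit.Site d) (k : Fin d), perCfg (towerP L m (j + 1)) (UlevOf L m (n + 1) U j) x k ∈ U1 𝔸)
        (hreg : ∀ (j : ℕ) (y : TSite d (towerP L m j)) (k : Fin d) (ρ' : Fin d → Fin L),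
          ‖((Wcx L (perCfg (towerP L m (j + 1)) (UlevOf L m (n + 1) U j)) (cornerSite L y) k (boxVec L ρ') : 𝔸ˣ) : 𝔸) - 1‖ ≤ αU j),
      ∀ (εU : ℕ → ℝ), (∀ j, 0 ≤ εU j) → (∀ j, εU j ≤ 1) → (∀ j < n + 1, εU j ≤ α * r ^ j) →
        (∀ (j : ℕ) (bd : Bond d (towerP L m (j + 1))), ‖(UlevOf L m (n + 1) U j bd : 𝔸) - 1‖ ≤ εU j) →
        (∀ (j : ℕ) (bd : Bond d (towerP L m (j + 1))), UlevOf L m (n + 1) U j bd ∈ U1 𝔸) →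
        (∀ (j : ℕ) (bd : Bond d (towerP L m (j + 1))) (w : W), ‖adTransportW φ (UlevOf L m (n + 1) U j) bd w‖ ≤ ‖w‖) →
      ∀ (hposU : ∀ x : SiteL2K ℂ d (towerP L m (n + 1)) c₀ W, x ≠ 0 → 0 < RCLike.re ⟪x, laplacePrimeAk L m n φ η U a' (c₁ := c₁) x⟫_ℂ)
        (hpos'₁ : ∀ x : SiteL2K ℂ d (towerP L m (n + 1)) c₀ W, x ≠ 0 →
          0 < RCLike.re ⟪x, laplacePrimeAk L m n φ η (fun _ : Bond d (towerP L m (n + 1)) => (1 : 𝔸ˣ)) a' (c₁ := c₁) x⟫_ℂ)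
        (hpos₁ : ∀ x : BondL2K ℂ d (towerP L m (n + 1)) c₀ W, x ≠ 0 →
          0 < RCLike.re ⟪x, laplaceAk L m n φ η (fun _ : Bond d (towerP L m (n + 1)) => (1 : 𝔸ˣ)) hL (fun _ => 0) (fun _ => by norm_num)
            (perCfg_UlevOf_one_mem_U1 L m (n + 1)) (norm_Wcx_UlevOf_one_sub_one_le L m (n + 1) (fun _ => 0) (fun _ => le_rfl)) τ
            (c₀ := c₀) (c₁ := c₁) a x⟫_ℂ)
        (rr : TSite d m → SiteL2K ℂ d m c₁ W →L[ℂ] SiteL2K ℂ d m c₁ W),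
        (∀ (y : TSite d m) (g : SiteL2K ℂ d m c₁ W) (y' : TSite d m),
          WL2.equiv ℂ (fun _ : TSite d m => c₁) W (rr y g) y' = if y' = y then WL2.equiv ℂ (fun _ : TSite d m => c₁) W g y' else 0) →
      ∀ (v : TSite d m) (f : BondL2K ℂ d (towerP L m (n + 1)) c₀ W) (F : ℝ),
        (∀ b', blockCoord (L ^ (n + 1)) m (siteCast (towerP_eq_fineP_pow L m (n + 1)) (bpos b')) ≠ v →
          WL2.equiv ℂ (fun _ : Bond d (towerP L m (n + 1)) => c₀) W f b' = 0) →
        (∀ b', ‖WL2.equiv ℂ (fun _ : Bond d (towerP L m (n + 1)) => c₀) W f b'‖ ≤ F) →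
      ∀ bd : Bond d (towerP L m (n + 1)),
        ‖WL2.equiv ℂ (fun _ : Bond d (towerP L m (n + 1)) => c₀) W
            (covDerivL2K ℂ c₀ ((η : ℂ))⁻¹ (adTransportW φ U)
                (((LinearMap.id : SiteL2K ℂ d (towerP L m (n + 1)) c₀ W →ₗ[ℂ] SiteL2K ℂ d (towerP L m (n + 1)) c₀ W) - RofUk L m n φ η U (c₀ := c₀))
                  (covDivL2K ℂ c₀ ((η : ℂ))⁻¹ (adTransportW φ fun b' => (U b')⁻¹)
                    (G1k L m n φ η (fun _ : Bond d (towerP L m (n + 1)) => (1 : 𝔸ˣ)) hL (fun _ => 0) (fun _ => by norm_num)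
                      (perCfg_UlevOf_one_mem_U1 L m (n + 1)) (norm_Wcx_UlevOf_one_sub_one_le L m (n + 1) (fun _ => 0) (fun _ => le_rfl)) τ
                      (c₀ := c₀) (c₁ := c₁) hpos₁ f))) -
              covDerivL2K ℂ c₀ ((η : ℂ))⁻¹ (adTransportW φ (fun _ : Bond d (towerP L m (n + 1)) => (1 : 𝔸ˣ)))
                (((LinearMap.id : SiteL2K ℂ d (towerP L m (n + 1)) c₀ W →ₗ[ℂ] SiteL2K ℂ d (towerP L m (n + 1)) c₀ W) -
                    RofUk L m n φ η (fun _ : Bond d (towerP L m (n + 1)) => (1 : 𝔸ˣ)) (c₀ := c₀))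
                  (covDivL2K ℂ c₀ ((η : ℂ))⁻¹ (adTransportW φ fun b' => ((fun _ : Bond d (towerP L m (n + 1)) => (1 : 𝔸ˣ)) b')⁻¹)
                    (G1k L m n φ η (fun _ : Bond d (towerP L m (n + 1)) => (1 : 𝔸ˣ)) hL (fun _ => 0) (fun _ => by norm_num)
                      (perCfg_UlevOf_one_mem_U1 L m (n + 1)) (norm_Wcx_UlevOf_one_sub_one_le L m (n + 1) (fun _ => 0) (fun _ => le_rfl)) τ
                      (c₀ := c₀) (c₁ := c₁) hpos₁ f)))) bd‖ ≤
          K * α * Real.exp (-(κ * tdist m (blockCoord (L ^ (n + 1)) m (siteCast (towerP_eq_fineP_pow L m (n + 1)) (bpos bd))) v)) * F := by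
  classical
  -- (0) the four letter suppliers, `∃`-first, and the constants
  obtain ⟨αR, KR, δR, hαR, hKR, hδR, HR2⟩ := exists_gradLetter_RofUk_sub_flat L φ hMφ hMφ' hφ hφ' ha ha' hr0 hr1 τ hτ hCτ hρw hτ₁ hτ₂ hφτ hMτ b hM₂ hrepr hd hL hL3
  obtain ⟨KW, δW, hKW, hδW, HW3⟩ := exists_gradLetter_W_one L φ hMφ hMφ' hφ hφ' ha ha' hr0 hr1 τ hτ hCτ hρw hτ₁ hτ₂ hφτ hMτ b hM₂ hrepr hd hL hL3
  obtain ⟨αD, KD, κD, hαD, hKD, hκD, HDIV⟩ := exists_letters_covDiv_G1k_one hd L hL hL3 φ hMφ hMφ' hφ hφ' hstar ha ha' τ hτ hCτ hτm hMτ hρw hτ₁ hτ₂ hφτ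
  obtain ⟨αP, BP, δP, hαP, hBP, hδP, HROW⟩ := exists_local_letters_GpOfUk_RofUk hd L hL hL3 φ hMφ hMφ' hφ hφ' ha ha' hr0 hr1 τ hτ hCτ hMτ hρw hτ₁ hτ₂ hφτ AQ
  set κ₀ : ℝ := min (min δR δW) (min κD δP) with hκ₀
  have hκ₀0 : 0 < κ₀ := lt_min (lt_min hδR hδW) (lt_min hκD hδP)
  have hκ₀R : κ₀ ≤ δR := (min_le_left _ _).trans (min_le_left _ _)
  have hκ₀W : κ₀ ≤ δW := (min_le_left _ _).trans (min_le_right _ _)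
  have hκ₀D : κ₀ ≤ κD := (min_le_right _ _).trans (min_le_left _ _)
  have hκ₀P : κ₀ ≤ δP := (min_le_right _ _).trans (min_le_right _ _)
  set S : ℝ := latticeConst d (κ₀ / 2) with hS
  have hS0 : 0 ≤ S := latticeConst_nonneg d (half_pos hκ₀0).le
  set K : ℝ := (2 * Mφ * Mφ' * (KD * (1 + BP) * S) * Real.exp (κ₀ / 2) + KD * KR * S + KD * KW * S) with hK
  have hK0 : 0 ≤ K := by positivity
  refine ⟨min (min αR αD) (min αP 1), K, κ₀ / 2, lt_min (lt_min hαR hαD) (lt_min hαP one_pos), hK0, by positivity, ?_⟩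
  intro n η hηL c₀ c₁ _ _ hw hρ m _ hm U α hα hαle hUb hUη hUw hpl hUst αU hα0U hα1 hAQ hU1 hreg εU hε0 hε1 hεr hlev hlev1 hRlev hposU hpos'₁ hpos₁ rr hrr
    v f F hfv hfF bd
  have hαR' : α ≤ αR := hαle.trans ((min_le_left _ _).trans (min_le_left _ _))
  have hαD' : α ≤ αD := hαle.trans ((min_le_left _ _).trans (min_le_right _ _))
  have hαP' : α ≤ αP := hαle.trans ((min_le_right _ _).trans (min_le_left _ _))
  have hα1' : α ≤ 1 := hαle.trans ((min_le_right _ _).trans (min_le_right _ _))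
  have hF : 0 ≤ F := (norm_nonneg _).trans (hfF bd)
  have hc₀ : (0 : ℝ) < c₀ := Fact.out
  have hLpos : (0 : ℝ) < (L : ℝ) ^ (n + 1) := pow_pos (by exact_mod_cast Nat.pos_of_ne_zero (NeZero.ne L)) _
  have hη : 0 < η := by
    by_contra h; push Not at h; nlinarith [mul_nonpos_of_nonpos_of_nonneg h hLpos.le]
  haveI : Nonempty (Bond d (towerP L m (n + 1))) := ⟨bd⟩
  haveI : Nonempty (TSite d (towerP L m (n + 1))) := ⟨bpos bd⟩
  -- names
  set piB : Bond d (towerP L m (n + 1)) → TSite d m := fun b' => blockCoord (L ^ (n + 1)) m (siteCast (towerP_eq_fineP_pow L m (n + 1)) (bpos b')) with hpiB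
  set piS : TSite d (towerP L m (n + 1)) → TSite d m := fun x => blockCoord (L ^ (n + 1)) m (siteCast (towerP_eq_fineP_pow L m (n + 1)) x) with hpiS
  set G := G1k L m n φ η (fun _ : Bond d (towerP L m (n + 1)) => (1 : 𝔸ˣ)) hL (fun _ => 0) (fun _ => by norm_num)
    (perCfg_UlevOf_one_mem_U1 L m (n + 1)) (norm_Wcx_UlevOf_one_sub_one_le L m (n + 1) (fun _ => 0) (fun _ => le_rfl)) τ (c₀ := c₀) (c₁ := c₁) hpos₁ with hGdef
  set DdU := covDivL2K ℂ c₀ ((η : ℂ))⁻¹ (adTransportW φ fun b' => (U b')⁻¹) with hDdU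
  set Dd1 := covDivL2K ℂ c₀ ((η : ℂ))⁻¹ (adTransportW φ fun b' => ((fun _ : Bond d (towerP L m (n + 1)) => (1 : 𝔸ˣ)) b')⁻¹) with hDd1
  set DU := covDerivL2K ℂ c₀ ((η : ℂ))⁻¹ (adTransportW φ U) with hDU
  set D1 := covDerivL2K ℂ c₀ ((η : ℂ))⁻¹ (adTransportW φ (fun _ : Bond d (towerP L m (n + 1)) => (1 : 𝔸ˣ))) with hD1
  set RU := RofUk L m n φ η U (c₀ := c₀) with hRU
  set R1 := RofUk L m n φ η (fun _ : Bond d (towerP L m (n + 1)) => (1 : 𝔸ˣ)) (c₀ := c₀) with hR1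
  set Id := (LinearMap.id : SiteL2K ℂ d (towerP L m (n + 1)) c₀ W →ₗ[ℂ] SiteL2K ℂ d (towerP L m (n + 1)) c₀ W) with hId
  -- the CLMs entering the three compositions
  obtain ⟨T1, hT1⟩ : ∃ T : BondL2K ℂ d (towerP L m (n + 1)) c₀ W →L[ℂ] SiteL2K ℂ d (towerP L m (n + 1)) c₀ W,
      T = LinearMap.toContinuousLinearMap (DdU ∘ₗ G) := ⟨_, rfl⟩
  obtain ⟨T1', hT1'⟩ : ∃ T : BondL2K ℂ d (towerP L m (n + 1)) c₀ W →L[ℂ] SiteL2K ℂ d (towerP L m (n + 1)) c₀ W,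
      T = LinearMap.toContinuousLinearMap ((DdU - Dd1) ∘ₗ G) := ⟨_, rfl⟩
  obtain ⟨T2, hT2⟩ : ∃ T : SiteL2K ℂ d (towerP L m (n + 1)) c₀ W →L[ℂ] SiteL2K ℂ d (towerP L m (n + 1)) c₀ W,
      T = LinearMap.toContinuousLinearMap (Id - RU) := ⟨_, rfl⟩
  obtain ⟨T3, hT3⟩ : ∃ T : SiteL2K ℂ d (towerP L m (n + 1)) c₀ W →L[ℂ] BondL2K ℂ d (towerP L m (n + 1)) c₀ W,
      T = LinearMap.toContinuousLinearMap (D1 ∘ₗ (RU - R1)) := ⟨_, rfl⟩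
  obtain ⟨T4, hT4⟩ : ∃ T : SiteL2K ℂ d (towerP L m (n + 1)) c₀ W →L[ℂ] BondL2K ℂ d (towerP L m (n + 1)) c₀ W,
      T = LinearMap.toContinuousLinearMap (D1 ∘ₗ (Id - R1)) := ⟨_, rfl⟩
  -- (1) the letters in `letter_comp` shape, all at the rate `κ₀`
  have hweak : ∀ {r' : ℝ} (t : ℝ), κ₀ ≤ r' → 0 ≤ t → Real.exp (-(r' * t)) ≤ Real.exp (-(κ₀ * t)) := fun t hr ht =>
    Real.exp_le_exp.mpr (by nlinarith)
  have hL1 : ∀ (v : TSite d m) (f : BondL2K ℂ d (towerP L m (n + 1)) c₀ W) (F : ℝ), (∀ x, piB x ≠ v → WL2.equiv ℂ (fun _ : Bond d (towerP L m (n + 1)) => c₀) W f x = 0) →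
      (∀ x, ‖WL2.equiv ℂ (fun _ : Bond d (towerP L m (n + 1)) => c₀) W f x‖ ≤ F) →
      ∀ y, ‖WL2.equiv ℂ (fun _ : TSite d (towerP L m (n + 1)) => c₀) W (T1 f) y‖ ≤ KD * Real.exp (-(κ₀ * tdist m (piS y) v)) * F := by
    intro v f F hfv hfF y
    have hF : 0 ≤ F := (norm_nonneg _).trans (hfF bd)
    have h := (HDIV n η hηL c₀ c₁ hw hρ m hm U α hα hαD' hUb hUη hUw hpl hpos'₁ hpos₁ v f F hfv hfF y).1
    rw [hT1, LinearMap.coe_toContinuousLinearMap', LinearMap.comp_apply]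
    exact h.trans (mul_le_mul_of_nonneg_right (mul_le_mul_of_nonneg_left (hweak _ hκ₀D (tdist_nonneg _ _ _)) hKD) hF)
  have hL1' : ∀ (v : TSite d m) (f : BondL2K ℂ d (towerP L m (n + 1)) c₀ W) (F : ℝ), (∀ x, piB x ≠ v → WL2.equiv ℂ (fun _ : Bond d (towerP L m (n + 1)) => c₀) W f x = 0) →
      (∀ x, ‖WL2.equiv ℂ (fun _ : Bond d (towerP L m (n + 1)) => c₀) W f x‖ ≤ F) →
      ∀ y, ‖WL2.equiv ℂ (fun _ : TSite d (towerP L m (n + 1)) => c₀) W (T1' f) y‖ ≤ (KD * α) * Real.exp (-(κ₀ * tdist m (piS y) v)) * F := by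
    intro v f F hfv hfF y
    have hF : 0 ≤ F := (norm_nonneg _).trans (hfF bd)
    have h := (HDIV n η hηL c₀ c₁ hw hρ m hm U α hα hαD' hUb hUη hUw hpl hpos'₁ hpos₁ v f F hfv hfF y).2
    rw [hT1', LinearMap.coe_toContinuousLinearMap', LinearMap.comp_apply, LinearMap.sub_apply, WL2.equiv_sub, Pi.sub_apply]
    exact h.trans (mul_le_mul_of_nonneg_right (mul_le_mul_of_nonneg_left (hweak _ hκ₀D (tdist_nonneg _ _ _)) (mul_nonneg hKD hα)) hF)
  have hUgrad : ∀ (x : TSite d (towerP L m (n + 1))) (μ : Fin d), ‖(U (x, μ) : 𝔸) - U (unshift μ x, μ)‖ ≤ α * η ^ 2 := fun x μ => by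
    have h := hUw (unshift μ x) μ μ
    rwa [shift_unshift] at h
  have hL2 : ∀ (v : TSite d m) (h : SiteL2K ℂ d (towerP L m (n + 1)) c₀ W) (H : ℝ), (∀ x, piS x ≠ v → WL2.equiv ℂ (fun _ : TSite d (towerP L m (n + 1)) => c₀) W h x = 0) →
      (∀ x, ‖WL2.equiv ℂ (fun _ : TSite d (towerP L m (n + 1)) => c₀) W h x‖ ≤ H) →
      ∀ y, ‖WL2.equiv ℂ (fun _ : TSite d (towerP L m (n + 1)) => c₀) W (T2 h) y‖ ≤ (1 + BP) * Real.exp (-(κ₀ * tdist m (piS y) v)) * H := by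
    intro v h H hhv hhF y
    have hH : 0 ≤ H := (norm_nonneg _).trans (hhF (bpos bd))
    have hR := (HROW n η hηL c₀ c₁ hw hρ m hm U αU hα0U hα1 hU1 hreg εU hε0 hlev hlev1 α hα hαP' hUst hUb hUη hpl hUgrad hRlev hεr hAQ hposU v h H hhv hhF y).2.1
    rw [hT2, LinearMap.coe_toContinuousLinearMap', LinearMap.sub_apply, LinearMap.id_apply, WL2.equiv_sub, Pi.sub_apply]
    have hhy : ‖WL2.equiv ℂ (fun _ : TSite d (towerP L m (n + 1)) => c₀) W h y‖ ≤ Real.exp (-(κ₀ * tdist m (piS y) v)) * H := by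
      by_cases hy : piS y = v
      · rw [hy, tdist_self, mul_zero, neg_zero, Real.exp_zero, one_mul]; exact hhF y
      · rw [hhv y hy, norm_zero]; positivity
    calc _ ≤ ‖WL2.equiv ℂ (fun _ : TSite d (towerP L m (n + 1)) => c₀) W h y‖ + ‖WL2.equiv ℂ (fun _ : TSite d (towerP L m (n + 1)) => c₀) W (RU h) y‖ := norm_sub_le _ _
      _ ≤ Real.exp (-(κ₀ * tdist m (piS y) v)) * H + BP * Real.exp (-(κ₀ * tdist m (piS y) v)) * H :=
          add_le_add hhy (hR.trans (mul_le_mul_of_nonneg_right (mul_le_mul_of_nonneg_left (hweak _ hκ₀P (tdist_nonneg _ _ _)) hBP) hH))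
      _ = (1 + BP) * Real.exp (-(κ₀ * tdist m (piS y) v)) * H := by ring
  have hL3 : ∀ (v : TSite d m) (h : SiteL2K ℂ d (towerP L m (n + 1)) c₀ W) (H : ℝ), (∀ x, piS x ≠ v → WL2.equiv ℂ (fun _ : TSite d (towerP L m (n + 1)) => c₀) W h x = 0) →
      (∀ x, ‖WL2.equiv ℂ (fun _ : TSite d (towerP L m (n + 1)) => c₀) W h x‖ ≤ H) →
      ∀ b', ‖WL2.equiv ℂ (fun _ : Bond d (towerP L m (n + 1)) => c₀) W (T3 h) b'‖ ≤ (KR * α) * Real.exp (-(κ₀ * tdist m (piB b') v)) * H := by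
    intro v h H hhv hhF b'
    have hH : 0 ≤ H := (norm_nonneg _).trans (hhF (bpos bd))
    have h2 := HR2 n η hηL c₀ c₁ hw hρ m hm U α hα hαR' hUb hUη hUw hpl hUst αU hα1 hU1 hreg εU hε0 hε1 hεr hlev hlev1 hRlev hposU hpos'₁ rr hrr v h H hhv hhF
      (bpos b') b'.2
    rw [hT3, LinearMap.coe_toContinuousLinearMap', LinearMap.comp_apply]
    exact h2.trans (mul_le_mul_of_nonneg_right (mul_le_mul_of_nonneg_left (hweak _ hκ₀R (tdist_nonneg _ _ _)) (mul_nonneg hKR hα)) hH)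
  have hL4 : ∀ (v : TSite d m) (h : SiteL2K ℂ d (towerP L m (n + 1)) c₀ W) (H : ℝ), (∀ x, piS x ≠ v → WL2.equiv ℂ (fun _ : TSite d (towerP L m (n + 1)) => c₀) W h x = 0) →
      (∀ x, ‖WL2.equiv ℂ (fun _ : TSite d (towerP L m (n + 1)) => c₀) W h x‖ ≤ H) →
      ∀ b', ‖WL2.equiv ℂ (fun _ : Bond d (towerP L m (n + 1)) => c₀) W (T4 h) b'‖ ≤ KW * Real.exp (-(κ₀ * tdist m (piB b') v)) * H := by
    intro v h H hhv hhF b'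
    have hH : 0 ≤ H := (norm_nonneg _).trans (hhF (bpos bd))
    have h3 := HW3 n η hηL c₀ c₁ hw hρ m hm hpos'₁ rr hrr v h H hhv hhF (bpos b') b'.2
    rw [hT4, LinearMap.coe_toContinuousLinearMap', LinearMap.comp_apply]
    exact h3.trans (mul_le_mul_of_nonneg_right (mul_le_mul_of_nonneg_left (hweak _ hκ₀W (tdist_nonneg _ _ _)) hKW) hH)
  -- (2) the three compositions (row sum `S = K_d(κ₀/2)`)
  have hrow : ∀ w : TSite d m, ∑ u, Real.exp (-((κ₀ - κ₀ / 2) * tdist m w u)) ≤ S := fun w => by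
    rw [show κ₀ - κ₀ / 2 = κ₀ / 2 by ring]; exact torusSum_le d hm (half_pos hκ₀0) w
  have hδ0 : ∀ u v : TSite d m, 0 ≤ tdist m u v := fun u v => tdist_nonneg _ _ _
  have hδt : ∀ u y v : TSite d m, tdist m u v ≤ tdist m u y + tdist m y v := fun u y v => tdist_triangle hm u y v
  have hκ'0 : (0 : ℝ) ≤ κ₀ / 2 := by positivity
  have hκ'1 : κ₀ / 2 ≤ κ₀ := by linarith
  have hCA := letter_comp (𝕜 := ℂ) (tdist m) piB piS piS T1 T2 hδ0 hδt hKD (by positivity) hκ'0 hκ'1 hL1 hL2 hrow v f F hfv hfF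
  have hCB := letter_comp (𝕜 := ℂ) (tdist m) piB piS piB T1 T3 hδ0 hδt hKD (mul_nonneg hKR hα) hκ'0 hκ'1 hL1 hL3 hrow v f F hfv hfF
  have hCC := letter_comp (𝕜 := ℂ) (tdist m) piB piS piB T1' T4 hδ0 hδt (mul_nonneg hKD hα) hKW hκ'0 hκ'1 hL1' hL4 hrow v f F hfv hfF
  -- (3) the first term: `(D_U − D_1)` applied to the site field `t = (T2 ∘ T1) f`, read at `bd`
  set E : ℝ := Real.exp (-(κ₀ / 2 * tdist m (piB bd) v)) with hE
  have hRε : ∀ (b' : Bond d (towerP L m (n + 1))) (w : W), ‖adTransportW φ U b' w - w‖ ≤ 2 * Mφ * Mφ' * (α * η) * ‖w‖ := fun b' w => by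
    have h := norm_adTransportW_sub_adTransportW_le φ hφ hφ' hMφ' U (fun _ : Bond d (towerP L m (n + 1)) => (1 : 𝔸ˣ)) b' b' (hUb b') (one_mem _) w
    rw [B5Eq172HodgePositivity.adTransportW_one, LinearMap.id_apply, Units.val_one] at h
    exact h.trans (by gcongr; exact hUη b')
  have hcn : ‖((η : ℂ))⁻¹‖ = η⁻¹ := by rw [norm_inv, Complex.norm_real, Real.norm_eq_abs, abs_of_pos hη]
  have hηne : η ≠ 0 := hη.ne'
  have hstep : tdist m (piB bd) v ≤ tdist m (piS (btgt bd)) v + 1 := by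
    have h1 := tdist_bigBlock_bpos_btgt_le_one (L := L) (m := m) (k := n + 1) hm bd
    have h := tdist_triangle hm (piB bd) (piS (btgt bd)) v
    show tdist m (blockCoord (L ^ (n + 1)) m (siteCast (towerP_eq_fineP_pow L m (n + 1)) (bpos bd))) v ≤ _
    linarith
  have hTerm1 : ‖WL2.equiv ℂ (fun _ : Bond d (towerP L m (n + 1)) => c₀) W (DU ((T2 ∘L T1) f) - D1 ((T2 ∘L T1) f)) bd‖ ≤
      2 * Mφ * Mφ' * α * (KD * (1 + BP) * S * Real.exp (κ₀ / 2)) * E * F := by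
    rw [WL2.equiv_sub, Pi.sub_apply, hDU, hD1, equiv_covDerivL2K, equiv_covDerivL2K, adTransportW_one_fun φ, covDeriv_sub_flat_apply, norm_smul, hcn]
    have ht := hCA (btgt bd)
    have hexp : Real.exp (-(κ₀ / 2 * tdist m (piS (btgt bd)) v)) ≤ Real.exp (κ₀ / 2) * E := by
      rw [hE, ← Real.exp_add]; exact Real.exp_le_exp.mpr (by nlinarith [hstep])
    calc η⁻¹ * ‖adTransportW φ U bd (WL2.equiv ℂ (fun _ : TSite d (towerP L m (n + 1)) => c₀) W ((T2 ∘L T1) f) (btgt bd)) -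
            WL2.equiv ℂ (fun _ : TSite d (towerP L m (n + 1)) => c₀) W ((T2 ∘L T1) f) (btgt bd)‖
        ≤ η⁻¹ * (2 * Mφ * Mφ' * (α * η) * (KD * (1 + BP) * S * Real.exp (-(κ₀ / 2 * tdist m (piS (btgt bd)) v)) * F)) :=
          mul_le_mul_of_nonneg_left ((hRε _ _).trans (mul_le_mul_of_nonneg_left ht (by positivity))) (inv_nonneg.mpr hη.le)
      _ ≤ η⁻¹ * (2 * Mφ * Mφ' * (α * η) * (KD * (1 + BP) * S * (Real.exp (κ₀ / 2) * E) * F)) := by gcongr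
      _ = (η⁻¹ * η) * (2 * Mφ * Mφ' * α * (KD * (1 + BP) * S * Real.exp (κ₀ / 2)) * E * F) := by ring
      _ = 2 * Mφ * Mφ' * α * (KD * (1 + BP) * S * Real.exp (κ₀ / 2)) * E * F := by rw [inv_mul_cancel₀ hηne, one_mul]
  -- (4) the algebraic split of the smooth word
  have hflat1 : Dd1 = covDivL2K ℂ c₀ ((η : ℂ))⁻¹ (fun _ : Bond d (towerP L m (n + 1)) => (LinearMap.id : W →ₗ[ℂ] W)) := by
    rw [hDd1, B9Eq373BondHessianTwoBackgroundLetterTower.inv_one_fun, adTransportW_one_fun φ]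
  have hsplit : DU ((Id - RU) (DdU (G f))) - D1 ((Id - R1) (Dd1 (G f))) =
      (DU ((T2 ∘L T1) f) - D1 ((T2 ∘L T1) f)) + ((T4 ∘L T1') f - (T3 ∘L T1) f) := by
    simp only [hT1, hT1', hT2, hT3, hT4, hId, ContinuousLinearMap.coe_comp, Function.comp_apply, LinearMap.coe_toContinuousLinearMap', sub_apply,
      LinearMap.comp_apply, LinearMap.sub_apply, LinearMap.id_apply, map_sub]
    abel
  rw [hsplit, WL2.equiv_add, Pi.add_apply]
  have hB : ‖WL2.equiv ℂ (fun _ : Bond d (towerP L m (n + 1)) => c₀) W ((T4 ∘L T1') f - (T3 ∘L T1) f) bd‖ ≤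
      KD * α * KW * S * E * F + KD * (KR * α) * S * E * F := by
    rw [WL2.equiv_sub, Pi.sub_apply]
    exact (norm_sub_le _ _).trans (add_le_add (hCC bd) (hCB bd))
  refine (norm_add_le _ _).trans ((add_le_add hTerm1 hB).trans (le_of_eq ?_))
  rw [hK]
  ring

end Literature.MathematicalPhysics.QuantumFieldTheory.Balaban1983to89.B9Eq376BondProjWordTwoBackgroundLetterTower

end
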